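import Mathlib
import Literature.MathematicalPhysics.QuantumFieldTheory.Balaban1983to89.B4Strip

/-!
# `Balaban1983to89.B5Strip145` — the complex strip for the multiplier (1.45) of
T. Bałaban, *Propagators and renormalization transformations for lattice gauge theories. I*,
Commun. Math. Phys. **95**, 17–40 (1984) [Balaban1984PropagatorsI] (cell paper B5), p. 26 [PDF 10] and p. 38 [PDF 22].

CITATION HEADER (lean-in-tree rule 2026-08-18).  This module is a SUPPLEMENT to the typed skeleton `…Balaban1983to89.B5`
(sibling file, untouched) and a companion of `…Balaban1983to89.B4Strip` (sibling file by the B04 cell, untouched, IMPORTED: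
its symbols `S1`, `Sxi`, `U`, `DeltaXi`, `Delta1`, `shift`, `Strip`, its regrouped denominator `E` and the abstract
perturbation lemma `strip_lower_bound` are reused verbatim).  It is NOT a quotation of a proof printed in B5: the paper PRINTS
the momentum representation (p. 26 [PDF 10], verbatim)

  (1.45)  `(Q′_k G′_k² Q′_k*)(p′) = Σ_l |u_k(p′+l)|² Δ₀²(p′)/Δ²(p′+l) · [a Σ_l |u_k(p′+l)|² Δ₀(p′)/Δ(p′+l) + Δ₀(p′)]⁻²,  p′ ∈ T₁^{(k)}.`

  *"From this representation and from the bounds (2.51), (2.52) of that paper, it follows that there are positive constants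
  γ₀, γ₁, in fact γ₀ dependent only on d, γ₁ = a⁻², such that γ₀ ≦ Q′_kG′_k²Q′_k* ≦ γ₁."* … *"The operator R given by (1.44)
  is of course by definition independent of a and we can take arbitrary a in the representation, e.g. a = 1, which is most
  convenient for bounds."*

and then ASSERTS, for the exponential decay (1.126)–(1.127) of the kernel of `∂P∂*`, `P = G′Q′*(Q′G′²Q′*)⁻¹Q′G′` (p. 38
[PDF 22], the sentence before (1.126), verbatim): *"They follow from the representation P = G′Q′*(Q′G′²Q′*)⁻¹Q′G′, from
Lemma 2.4 of [2], and the representation (1.45) and the analyticity method of proving an exponential decay (see the proof of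
Lemma 2.4 in [2])"*.  The step proper to B5 in this sentence — that the multiplier (1.45) extends to a complex strip
`|Im p′_μ| ≤ κ` around the Brillouin zone as a ZERO-FREE analytic function with modulus bounded above and below UNIFORMLY in
`k` (so that the unit-lattice kernel of `(Q′_kG′_k²Q′_k*)⁻¹` decays exponentially, uniformly in `k`, by the translation
`p′ → p′ + iq`) — is written in neither B5 nor [2] = B4 (census objection G-B5-06a part (b) = C-B5-6 item (c) of the cell's
GAPS.md).  The cell's rule: such a step enters ONLY as (a) kernel-checked theorems of this package and (b) a written proof whose
single external input is a PUBLISHED theorem quoted verbatim.  (b) is the companion note `HOME/b2b-balaban-b05-g2/QGGQ-strip-census.md`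
(census certification C-B5-18; its one external input is Cauchy's Estimate — Conway, *Functions of One Complex Variable I*,
GTM 11 (1978), IV.2.14 p. 73: "Let f be analytic in B(a;R) and suppose |f(z)| ≤ M for all z in B(a;R). Then |f⁽ⁿ⁾(a)| ≤ n!M/Rⁿ"
[Conway1978] — exactly as for `B4Strip`); (a) is this file.

DICTIONARY (B5 ↔ `B4Strip`, all at `m² = 0`, `n = L^k = η⁻¹`):  `Δ₀(p′) = Σ_μ |e^{ip′_μ} − 1|² = Delta1 0 p′`;
`Δ(p′+l) = Σ_μ η⁻²|e^{iη(p′+l)_μ} − 1|² = DeltaXi n 0 (shift n k p′)` (`l_μ = 2πk_μ`); `|u_k(p′+l)|² = U n k p′` (the block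
averaging symbol (1.31) is the symbol (2.45) of [2]); hence the square bracket of (1.45) is `Delta1 0 p′ · (1 + aψ)`,
`ψ = Σ_k U_k/DeltaXi_k`, and `[2]`'s regrouped denominator `B4Strip.E n a 0 p′ = DeltaXi₀ · (1 + aψ)` (`B4Strip.E_eq_mul`).

WHAT IS KERNEL-CHECKED HERE (0 sorry):
* `Ncal` — the REGROUPED NUMERATOR `𝒩 = U₀ + DeltaXi₀² · Σ_{l≠0} U_l/DeltaXi_l²` and `Ncal_eq_mul`: where `DeltaXi₀ ≠ 0`,
  `𝒩 = DeltaXi₀² · Σ_l U_l/DeltaXi_l²`;  `mReg = 𝒩/E²` and `mReg_eq_m145`: off the zero sets of `DeltaXi₀`, `Delta1`, `E`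
  the regrouped multiplier IS the printed (1.45) (`m145`, transcribed literally); `real_offzero` / `m145_eq_mReg_real`: this
  covers every real `p′ ≠ 0` of the Brillouin zone (`a > 0`, `n ≥ 1`).  WHY regroup: the `l = 0` summand of the
  printed numerator, `U₀ Δ₀²/Δ²(p′)`, and the printed bracket have poles on the complex zero-cone of `Δ(p′) = DeltaXi₀`, which
  meets EVERY strip (`B4Strip.printed_factor_has_poles` exhibits the cone points `p⋆(t)`, `d = 2`, `n = 2`); only `𝒩/E²` —
  entire symbols over the zero-free `E` — continues.  This is the complex version of the `p′ → 0` cancellation of B5 p. 32.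
* `Ncalr_ge` / `Ncal_re_ge` — REAL POSITIVITY of the numerator: `𝒩 ≥ U₀ ≥ (4/π²)^d = (2/π)^{2d}` on the Brillouin zone, every
  `n ≥ 1` (the `O(1)` behind "γ₀ dependent only on d", p. 26); with `B4Strip.Er_ge` (`E ≥ a(2/π)^{2d}`) this is the real-axis
  input of the strip argument.
* `Ncal_lower_of_ImLipschitz` — real positivity + an imaginary-direction Lipschitz bound ⇒ `|𝒩| ≥ ½(2/π)^{2d}` on `Strip d κ`
  when `Λ_N d κ ≤ ½(2/π)^{2d}` (`B4Strip.strip_lower_bound`).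
* `m_bounds_of_leaves` — on `Strip d κ`: the two lower bounds and sup bounds `|E| ≤ M_E`, `|𝒩| ≤ M_N` give `E ≠ 0`, `𝒩 ≠ 0` and
  `c_m ≤ |mReg| ≤ C_m` with `c_m = ½(2/π)^{2d}/M_E²`, `C_m = M_N/(½a(2/π)^{2d})²` — the complex version of `γ₀ ≦ Q′G′²Q′* ≦ γ₁`.
* `UniformStrip145` / `UniformLeaves145` / `uniformStrip145_of_leaves` — the `k`-UNIFORM statement: if the four analytic leaves
  (Im-Lipschitz constants `Λ_E`, `Λ_N` and sup bounds `M_E`, `M_N` on strips of half-width `≤ r`) hold with constants independent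
  of `n = L^k` and of `a ∈ [a₋, a₊]`, then ONE strip half-width `κ₀ = min{r, c_E/(Λ_E d+1), c_N/(Λ_N d+1)}` and constants `c, C`
  serve every `k` — the content of G-B5-06a (b).  The leaves are discharged in QGGQ-strip-census.md §§1–2 (explicit:
  `r = 1/(4√d)`, `M_N = N₊(d) = 2.495^d + (10.2d)²C_U/3.74²`, `M_E = D₊(d,a)`, `C_U = 8.79^d − 2.495^d`, `Λ = M/r` by Cauchy's
  Estimate on coordinate discs), numerically cross-checked on the strip (kit job j039582: d ≤ 4, n ≤ 64, no violation).

NOT TYPED (markdown only, QGGQ-strip-census.md §3): the Paley–Wiener / contour-shift step `|(Q′G′²Q′*)⁻¹(y,y′)| ≤ c_m⁻¹ e^{−κ|y−y′|_∞}`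
(finite torus: Poisson periodisation) and parts (a), (c) of G-B5-06a (the η-lattice kernels of `G′Q′*`, `Q′G′`, `∂G′Q′*`,
`Q′G′∂*` = [2]'s Theorem, whose own strip step is `B4Strip` / G-B4-02c; lattice convolution).  Value = kernel skeleton of a
located, supplied step; NOT summit progress.
-/

namespace Literature.MathematicalPhysics.QuantumFieldTheory.Balaban1983to89.B5Strip145

open Complex Finset
open Literature.MathematicalPhysics.QuantumFieldTheory.Balaban1983to89.B4Strip

noncomputable section

variable {d : ℕ}

/-! ### The regrouped numerator `𝒩` and the multiplier (1.45) -/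

/-- `X_{≠0}(p′) = Σ_{l ≠ 0} |u(p′+l)|² / Δ²(p′+l)` — the part of the numerator sum of (1.45) that is analytic on the whole
strip (`Δ(p′+l)`, `l ≠ 0`, has positive real part there). [cite: Balaban1984PropagatorsI, (1.45) p.26 (the l ≠ 0 part of the first sum, audit regrouping)] -/
def Xne (n : ℕ) [NeZero n] (p : Fin d → ℂ) : ℂ :=
  ∑ k ∈ (Finset.univ.erase (fun _ => (0 : Fin n))), U n k p / (DeltaXi n 0 (shift n k p)) ^ 2

/-- real form of `Xne`. [folklore] -/
def Xner (n : ℕ) [NeZero n] (s : Fin d → ℝ) : ℝ :=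
  ∑ k ∈ (Finset.univ.erase (fun _ => (0 : Fin n))), Ur n k s / (DeltaXir n 0 (shiftr n k s)) ^ 2

/-- THE REGROUPED NUMERATOR `𝒩(p′) = |u(p′)|² + Δ²(p′) · Σ_{l≠0} |u(p′+l)|²/Δ²(p′+l)` = `Δ²(p′)/Δ₀²(p′)` times the first sum
of (1.45); a polynomial in the entire symbols over denominators `Δ(p′+l)`, `l ≠ 0`, only. [cite: Balaban1984PropagatorsI, (1.45) p.26 (first sum, regrouped by the audit)] -/
def Ncal (n : ℕ) [NeZero n] (p : Fin d → ℂ) : ℂ :=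
  U n (fun _ => (0 : Fin n)) p + (DeltaXi n 0 p) ^ 2 * Xne n p

/-- real form of `Ncal`. [folklore] -/
def Ncalr (n : ℕ) [NeZero n] (s : Fin d → ℝ) : ℝ :=
  Ur n (fun _ => (0 : Fin n)) s + (DeltaXir n 0 s) ^ 2 * Xner n s

/-- THE PRINTED MULTIPLIER (1.45), transcribed literally (`l` ranges over the residues `2πk`, `k ∈ {0,…,n−1}^d`; `Δ₀ = Delta1 0`,
`Δ(p′+l) = DeltaXi n 0 (shift n k p′)`, `|u_k(p′+l)|² = U n k p′`):
`(Q′_kG′_k²Q′_k*)(p′) = Σ_l |u_k(p′+l)|² Δ₀²(p′)/Δ²(p′+l) · [a Σ_l |u_k(p′+l)|² Δ₀(p′)/Δ(p′+l) + Δ₀(p′)]⁻²`. [cite: Balaban1984PropagatorsI, (1.45) p.26] -/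
def m145 (n : ℕ) [NeZero n] (a : ℝ) (p : Fin d → ℂ) : ℂ :=
  (∑ k : Fin d → Fin n, U n k p * (Delta1 0 p) ^ 2 / (DeltaXi n 0 (shift n k p)) ^ 2) *
    ((a * ∑ k : Fin d → Fin n, U n k p * Delta1 0 p / DeltaXi n 0 (shift n k p)) + Delta1 0 p)⁻¹ ^ 2

/-- THE REGROUPED MULTIPLIER `mReg = 𝒩/E²`, `E = B4Strip.E n a 0` = `Δ(p′)·[1 + aΣ_l |u(p′+l)|²/Δ(p′+l)]` — the form of (1.45)
that continues analytically to the strip. [cite: Balaban1984PropagatorsI, (1.45) p.26 (regrouped by the audit)] -/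
def mReg (n : ℕ) [NeZero n] (a : ℝ) (p : Fin d → ℂ) : ℂ :=
  Ncal n p / (E n a 0 p) ^ 2

/-- where `Δ(p′) ≠ 0` the regrouped numerator is `Δ²(p′) · Σ_l |u(p′+l)|²/Δ²(p′+l)` (all `l`). [folklore] -/
theorem Ncal_eq_mul (n : ℕ) [NeZero n] (p : Fin d → ℂ) (h : DeltaXi n 0 p ≠ 0) :
    Ncal n p = (DeltaXi n 0 p) ^ 2 * ∑ k : Fin d → Fin n, U n k p / (DeltaXi n 0 (shift n k p)) ^ 2 := by
  unfold Ncal Xne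
  rw [← Finset.add_sum_erase Finset.univ _ (Finset.mem_univ (fun _ => (0 : Fin n))), shift_zero, mul_add]
  congr 1
  field_simp

/-- pulling the `p′`-only factor `Δ₀²(p′)` out of the first sum of (1.45). [folklore] -/
theorem sum_num_factor (n : ℕ) [NeZero n] (p : Fin d → ℂ) :
    ∑ k : Fin d → Fin n, U n k p * (Delta1 0 p) ^ 2 / (DeltaXi n 0 (shift n k p)) ^ 2
      = (Delta1 0 p) ^ 2 * ∑ k : Fin d → Fin n, U n k p / (DeltaXi n 0 (shift n k p)) ^ 2 := by
  rw [Finset.mul_sum]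
  exact Finset.sum_congr rfl (fun k _ => by ring)

/-- pulling the `p′`-only factor `Δ₀(p′)` out of the bracket sum of (1.45). [folklore] -/
theorem sum_den_factor (n : ℕ) [NeZero n] (p : Fin d → ℂ) :
    ∑ k : Fin d → Fin n, U n k p * Delta1 0 p / DeltaXi n 0 (shift n k p)
      = Delta1 0 p * ∑ k : Fin d → Fin n, U n k p / DeltaXi n 0 (shift n k p) := by
  rw [Finset.mul_sum]
  exact Finset.sum_congr rfl (fun k _ => by ring)

/-- IDENTITY (kernel): off the zero sets of `Δ(p′)`, `Δ₀(p′)` and `E(p′)` — in particular for every real `p′ ≠ 0` of the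
Brillouin zone — the regrouped multiplier `𝒩/E²` IS the printed (1.45).  (`Δ₀²` cancels between the first sum and the
bracket⁻²; `Δ²(p′)` cancels between `𝒩` and `E²`.) [cite: Balaban1984PropagatorsI, (1.45) p.26] -/
theorem mReg_eq_m145 (n : ℕ) [NeZero n] (a : ℝ) (p : Fin d → ℂ) (hD : DeltaXi n 0 p ≠ 0)
    (h1 : Delta1 0 p ≠ 0) (hE : E n a 0 p ≠ 0) : mReg n a p = m145 n a p := by
  have hψ : (1 + (a : ℂ) * ∑ k : Fin d → Fin n, U n k p / DeltaXi n 0 (shift n k p)) ≠ 0 := by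
    intro h0
    apply hE
    rw [E_eq_mul n a 0 p hD, h0, mul_zero]
  unfold mReg m145
  rw [Ncal_eq_mul n p hD, E_eq_mul n a 0 p hD, sum_num_factor, sum_den_factor]
  generalize (∑ k : Fin d → Fin n, U n k p / (DeltaXi n 0 (shift n k p)) ^ 2) = X
  generalize hS : (∑ k : Fin d → Fin n, U n k p / DeltaXi n 0 (shift n k p)) = ψ
  rw [hS] at hψ
  rw [show (a : ℂ) * (Delta1 0 p * ψ) + Delta1 0 p = Delta1 0 p * (1 + (a : ℂ) * ψ) by ring]
  generalize hw : (1 + (a : ℂ) * ψ) = w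
  rw [hw] at hψ
  field_simp

/-- on the punctured real Brillouin zone (`|s_μ| ≤ π`, some `s_μ ≠ 0`) none of `Δ(s)`, `Δ₀(s)`, `E(s)` vanishes (`a > 0`,
`n ≥ 1`), so there the printed (1.45) and the regrouped multiplier agree (`mReg_eq_m145`); at `s = 0` the printed formula is
`0/0`-shaped while `𝒩/E²` is continuous (its value `U₀/(aU₀)² = a⁻²` at `p′ = 0`). [folklore] -/
theorem real_offzero (n : ℕ) [NeZero n] (hn : 1 ≤ n) (a : ℝ) (ha : 0 < a) (s : Fin d → ℝ)
    (hs : ∀ μ, |s μ| ≤ Real.pi) (μ : Fin d) (hμ : s μ ≠ 0) :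
    DeltaXi n 0 (ofRealVec s) ≠ 0 ∧ Delta1 0 (ofRealVec s) ≠ 0 ∧ E n a 0 (ofRealVec s) ≠ 0 := by
  refine ⟨?_, ?_, ?_⟩
  · rw [DeltaXi_ofReal]
    have h1 : 0 < Sxir n (s μ) := Sxir_pos n hn (s μ) hμ (hs μ)
    have h2 : Sxir n (s μ) ≤ ∑ ν, Sxir n (s ν) :=
      Finset.single_le_sum (fun ν _ => Sxir_nonneg n (s ν)) (Finset.mem_univ μ)
    have h3 : 0 < DeltaXir n 0 s := by unfold DeltaXir; linarith
    exact_mod_cast h3.ne'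
  · rw [Delta1_ofReal]
    have h0 : 0 < (s μ) ^ 2 := lt_of_le_of_ne (sq_nonneg _) (Ne.symm (pow_ne_zero 2 hμ))
    have h1 : 0 < S1r (s μ) := by
      have h4 := S1r_ge (s μ) (hs μ)
      have h5 : 0 < 4 * (s μ) ^ 2 / Real.pi ^ 2 := by positivity
      linarith
    have h2 : S1r (s μ) ≤ ∑ ν, S1r (s ν) :=
      Finset.single_le_sum (fun ν _ => S1r_nonneg (s ν)) (Finset.mem_univ μ)
    have h3 : 0 < Delta1r 0 s := by unfold Delta1r; linarith
    exact_mod_cast h3.ne'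
  · intro h0
    have h1 := E_re_ge n hn a 0 ha.le le_rfl s hs
    rw [h0, norm_zero] at h1
    have h2 : 0 < a * (4 / Real.pi ^ 2) ^ d := by positivity
    linarith

/-- hence on the punctured real Brillouin zone the printed (1.45) IS `𝒩/E²`. [cite: Balaban1984PropagatorsI, (1.45) p.26] -/
theorem m145_eq_mReg_real (n : ℕ) [NeZero n] (hn : 1 ≤ n) (a : ℝ) (ha : 0 < a) (s : Fin d → ℝ)
    (hs : ∀ μ, |s μ| ≤ Real.pi) (μ : Fin d) (hμ : s μ ≠ 0) :
    m145 n a (ofRealVec s) = mReg n a (ofRealVec s) := by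
  obtain ⟨hD, h1, hE⟩ := real_offzero n hn a ha s hs μ hμ
  exact (mReg_eq_m145 n a (ofRealVec s) hD h1 hE).symm

/-! ### Real positivity of the numerator: `𝒩 ≥ (2/π)^{2d}` on the Brillouin zone, every `n ≥ 1` -/

/-- `X_{≠0} ≥ 0` on real momenta. [folklore] -/
theorem Xner_nonneg (n : ℕ) [NeZero n] (s : Fin d → ℝ) : 0 ≤ Xner n s := by
  unfold Xner
  apply Finset.sum_nonneg
  intro k _
  exact div_nonneg (Ur_nonneg _ _ _) (sq_nonneg _)

/-- REAL POSITIVITY of the regrouped numerator: `𝒩(s) ≥ |u(s)|² ≥ (4/π²)^d` for `|s_μ| ≤ π`, every `n ≥ 1` (Jordan's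
inequality factor by factor, `B4Strip.Ur_zero_ge`; the `l ≠ 0` part is `≥ 0`).  This is the numerator half of
"γ₀ dependent only on d" (p. 26). [cite: Balaban1984PropagatorsI, p.26 (the sentence after (1.45))] -/
theorem Ncalr_ge (n : ℕ) [NeZero n] (hn : 1 ≤ n) (s : Fin d → ℝ) (hs : ∀ μ, |s μ| ≤ Real.pi) :
    (4 / Real.pi ^ 2) ^ d ≤ Ncalr n s := by
  unfold Ncalr
  have h1 := Ur_zero_ge n hn s hs
  have h2 : 0 ≤ (DeltaXir n 0 s) ^ 2 * Xner n s := mul_nonneg (sq_nonneg _) (Xner_nonneg n s)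
  linarith

/-- `𝒩` is real on real momenta. [folklore] -/
theorem Ncal_ofReal (n : ℕ) [NeZero n] (s : Fin d → ℝ) :
    Ncal n (ofRealVec s) = ((Ncalr n s : ℝ) : ℂ) := by
  unfold Ncal Ncalr Xne Xner
  simp only [U_ofReal, DeltaXi_ofReal, shift_ofReal]
  push_cast
  rfl

/-- real positivity in modulus form: `|𝒩(s)| ≥ (4/π²)^d` on the Brillouin zone. [folklore] -/
theorem Ncal_re_ge (n : ℕ) [NeZero n] (hn : 1 ≤ n) (s : Fin d → ℝ) (hs : ∀ μ, |s μ| ≤ Real.pi) :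
    (4 / Real.pi ^ 2) ^ d ≤ ‖Ncal n (ofRealVec s)‖ := by
  rw [Ncal_ofReal, Complex.norm_real]
  exact (Ncalr_ge n hn s hs).trans (le_abs_self _)

/-! ### The strip: lower bound of `𝒩`, two-sided bounds of the multiplier -/

/-- the imaginary-direction Lipschitz property of `𝒩` on the strip of half-width `κ` with constant `Λ` (discharged in the
companion note by Cauchy's Estimate from the modulus bound `|𝒩| ≤ N₊(d)` on the fat region, QGGQ-strip-census.md §§1–2). [folklore] -/
def ImLipschitzN (d n : ℕ) [NeZero n] (κ Λ : ℝ) : Prop :=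
  ∀ p ∈ Strip d κ, ‖Ncal n p - Ncal n (ofRealVec (reVec p))‖ ≤ Λ * ∑ μ, |(p μ).im|

/-- KERNEL FORM of the numerator lower bound on the strip: real positivity + imaginary Lipschitz ⇒ `|𝒩| ≥ ½(4/π²)^d` on
`Strip d κ` whenever `Λ d κ ≤ ½(4/π²)^d`; `n` enters only through `Λ`. [folklore] -/
theorem Ncal_lower_of_ImLipschitz (n : ℕ) [NeZero n] (hn : 1 ≤ n) (κ Λ : ℝ) (hΛ : 0 ≤ Λ)
    (hL : ImLipschitzN d n κ Λ) (hsmall : Λ * (d * κ) ≤ (4 / Real.pi ^ 2) ^ d / 2) :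
    ∀ p ∈ Strip d κ, (4 / Real.pi ^ 2) ^ d / 2 ≤ ‖Ncal n p‖ := by
  apply strip_lower_bound (Ncal n) _ Λ κ _ hL hΛ hsmall
  intro s hs
  have := Ncal_re_ge n hn s hs
  linarith

/-- the modulus of the regrouped multiplier is `|𝒩|/|E|²`. [folklore] -/
theorem norm_mReg (n : ℕ) [NeZero n] (a : ℝ) (p : Fin d → ℂ) :
    ‖mReg n a p‖ = ‖Ncal n p‖ / ‖E n a 0 p‖ ^ 2 := by
  unfold mReg
  rw [norm_div, norm_pow]

/-- TWO-SIDED STRIP BOUNDS from the four leaves (kernel): on `Strip d κ`, lower bounds `c_E ≤ |E|`, `c_N ≤ |𝒩|` with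
`c_E, c_N > 0` and sup bounds `|E| ≤ M_E`, `|𝒩| ≤ M_N` give `E ≠ 0`, `𝒩 ≠ 0` and `c_N/M_E² ≤ |𝒩/E²| ≤ M_N/c_E²` — the complex
version of `γ₀ ≦ Q′_kG′_k²Q′_k* ≦ γ₁` (p. 26), which is what the translation `p′ → p′ + iq` needs. [cite: Balaban1984PropagatorsI, p.26 (γ₀ ≦ Q′G′²Q′* ≦ γ₁) and p.38 (the sentence before (1.126))] -/
theorem m_bounds_of_leaves (n : ℕ) [NeZero n] (a κ cE cN ME MN : ℝ) (hcE : 0 < cE) (hcN : 0 < cN)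
    (hElow : ∀ p ∈ Strip d κ, cE ≤ ‖E n a 0 p‖) (hNlow : ∀ p ∈ Strip d κ, cN ≤ ‖Ncal n p‖)
    (hEup : ∀ p ∈ Strip d κ, ‖E n a 0 p‖ ≤ ME) (hNup : ∀ p ∈ Strip d κ, ‖Ncal n p‖ ≤ MN) :
    ∀ p ∈ Strip d κ, E n a 0 p ≠ 0 ∧ Ncal n p ≠ 0 ∧
      cN / ME ^ 2 ≤ ‖mReg n a p‖ ∧ ‖mReg n a p‖ ≤ MN / cE ^ 2 := by
  intro p hp
  have h1 := hElow p hp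
  have h2 := hNlow p hp
  have h3 := hEup p hp
  have h4 := hNup p hp
  have hEpos : 0 < ‖E n a 0 p‖ := lt_of_lt_of_le hcE h1
  have hNpos : 0 < ‖Ncal n p‖ := lt_of_lt_of_le hcN h2
  have hME : 0 < ME := lt_of_lt_of_le hEpos h3
  have hME' : ME ≠ 0 := hME.ne'
  have hcE' : cE ≠ 0 := hcE.ne'
  have hE2 : 0 < ‖E n a 0 p‖ ^ 2 := by positivity
  refine ⟨?_, ?_, ?_, ?_⟩
  · intro h0; rw [h0, norm_zero] at hEpos; exact lt_irrefl _ hEpos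
  · intro h0; rw [h0, norm_zero] at hNpos; exact lt_irrefl _ hNpos
  · rw [norm_mReg, le_div_iff₀ hE2]
    have h5 : ‖E n a 0 p‖ ^ 2 ≤ ME ^ 2 := by gcongr
    have h6 : cN / ME ^ 2 * ‖E n a 0 p‖ ^ 2 ≤ cN / ME ^ 2 * ME ^ 2 :=
      mul_le_mul_of_nonneg_left h5 (by positivity)
    have h7 : cN / ME ^ 2 * ME ^ 2 = cN := by field_simp
    linarith
  · rw [norm_mReg, div_le_iff₀ hE2]
    have h5 : cE ^ 2 ≤ ‖E n a 0 p‖ ^ 2 := by gcongr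
    have hMN : 0 ≤ MN := (norm_nonneg _).trans h4
    have h6 : MN / cE ^ 2 * cE ^ 2 ≤ MN / cE ^ 2 * ‖E n a 0 p‖ ^ 2 :=
      mul_le_mul_of_nonneg_left h5 (by positivity)
    have h7 : MN / cE ^ 2 * cE ^ 2 = MN := by field_simp
    linarith

/-! ### Uniformity in `k`: one strip and one pair of constants for every `n = L^k` -/

/-- THE `k`-UNIFORM STRIP STATEMENT for (1.45) (= census G-B5-06a part (b) / C-B5-6 item (c), the step B5 p. 38 asserts by
reference to "the analyticity method"): there are `κ > 0` and `0 < c ≤ C` depending on `(d, a₋, a₊)` only such that for EVERY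
`n = L^k ≥ 1` and every `a ∈ [a₋, a₊]` the regrouped multiplier `𝒩/E²` (= (1.45) off the zero set, `mReg_eq_m145`) has a
zero-free denominator and modulus in `[c, C]` on `Strip d κ`. [cite: Balaban1984PropagatorsI, p.38 (the sentence before (1.126); ASSERTED by reference in print, proof supplied by the audit, QGGQ-strip-census.md)] -/
def UniformStrip145 (d : ℕ) (aminus aplus : ℝ) : Prop :=
  ∃ κ c C : ℝ, 0 < κ ∧ 0 < c ∧
    ∀ (n : ℕ) [NeZero n] (a : ℝ), aminus ≤ a → a ≤ aplus →
      ∀ p ∈ Strip d κ, E n a 0 p ≠ 0 ∧ c ≤ ‖mReg n a p‖ ∧ ‖mReg n a p‖ ≤ C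

/-- THE FOUR ANALYTIC LEAVES (QGGQ-strip-census.md §§1–2: sup bounds `M_E = D₊`, `M_N = N₊` on the fat strip of half-width
`2r`, `r = 1/(4√d)`, from the elementary bounds on `2 − 2cos`, and the Im-Lipschitz constants `Λ = M/r` by Cauchy's Estimate
on coordinate discs): valid on every strip of half-width `κ ≤ r`, for all `n ≥ 1` and all `a ∈ [a₋, a₊]`, with constants
INDEPENDENT of `n`. [folklore] -/
def UniformLeaves145 (d : ℕ) (aminus aplus r ΛE ΛN ME MN : ℝ) : Prop :=
  0 < r ∧ 0 ≤ ΛE ∧ 0 ≤ ΛN ∧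
    ∀ (n : ℕ) [NeZero n] (a κ : ℝ), aminus ≤ a → a ≤ aplus → 0 < κ → κ ≤ r →
      ImLipschitz d n a 0 κ ΛE ∧ ImLipschitzN d n κ ΛN ∧
      (∀ p ∈ Strip d κ, ‖E n a 0 p‖ ≤ ME) ∧ (∀ p ∈ Strip d κ, ‖Ncal n p‖ ≤ MN)

/-- an auxiliary smallness computation: `κ ≤ c/(Λ d + 1)` gives `Λ (d κ) ≤ c`. [folklore] -/
theorem smallness_aux (Λ c κ : ℝ) (m : ℕ) (hΛ : 0 ≤ Λ) (hc : 0 ≤ c)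
    (hκ : κ ≤ c / (Λ * m + 1)) : Λ * (m * κ) ≤ c := by
  have hden : 0 < Λ * m + 1 := by positivity
  have h2 : Λ * m * κ ≤ Λ * m * (c / (Λ * m + 1)) := mul_le_mul_of_nonneg_left hκ (by positivity)
  have h3 : Λ * m * (c / (Λ * m + 1)) ≤ c := by
    rw [mul_div_assoc', div_le_iff₀ hden]
    nlinarith
  calc Λ * (m * κ) = Λ * m * κ := by ring
    _ ≤ c := h2.trans h3

/-- REDUCTION (kernel): the analytic leaves imply the `k`-uniform strip statement, with the explicit choice
`κ₀ = min r (min (c_E/(Λ_E d + 1)) (c_N/(Λ_N d + 1)))`, `c_E = ½ a₋ (4/π²)^d`, `c_N = ½ (4/π²)^d`, `c = c_N/M_E²`, `C = M_N/c_E²`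
(when the strip is nonempty; the constants are as in QGGQ-strip-census.md §2 up to the harmless replacement of polydisc
radii). [folklore] -/
theorem uniformStrip145_of_leaves (d : ℕ) (aminus aplus r ΛE ΛN ME MN : ℝ) (ha : 0 < aminus) (hME : 0 < ME)
    (h : UniformLeaves145 d aminus aplus r ΛE ΛN ME MN) : UniformStrip145 d aminus aplus := by
  obtain ⟨hr, hΛE, hΛN, hleaf⟩ := h
  set cE : ℝ := aminus * (4 / Real.pi ^ 2) ^ d / 2 with hcE
  set cN : ℝ := (4 / Real.pi ^ 2) ^ d / 2 with hcN
  have hcEpos : 0 < cE := by positivity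
  have hcNpos : 0 < cN := by positivity
  have hdE : 0 < ΛE * d + 1 := by positivity
  have hdN : 0 < ΛN * d + 1 := by positivity
  set κ : ℝ := min r (min (cE / (ΛE * d + 1)) (cN / (ΛN * d + 1))) with hκ
  have hκpos : 0 < κ := lt_min hr (lt_min (div_pos hcEpos hdE) (div_pos hcNpos hdN))
  have hκr : κ ≤ r := min_le_left _ _
  have hκE : κ ≤ cE / (ΛE * d + 1) := (min_le_right _ _).trans (min_le_left _ _)
  have hκN : κ ≤ cN / (ΛN * d + 1) := (min_le_right _ _).trans (min_le_right _ _)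
  refine ⟨κ, cN / ME ^ 2, MN / cE ^ 2, hκpos, div_pos hcNpos (by positivity), ?_⟩
  intro n _ a ha1 ha2 p hp
  have hn : 1 ≤ n := Nat.one_le_iff_ne_zero.mpr (NeZero.ne n)
  have ha0 : 0 ≤ a := le_trans ha.le ha1
  obtain ⟨hLE, hLN, hupE, hupN⟩ := hleaf n a κ ha1 ha2 hκpos hκr
  have hsmallE : ΛE * (d * κ) ≤ cE := smallness_aux ΛE cE κ d hΛE hcEpos.le hκE
  have hsmallN : ΛN * (d * κ) ≤ cN := smallness_aux ΛN cN κ d hΛN hcNpos.le hκN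
  have hca : cE ≤ a * (4 / Real.pi ^ 2) ^ d / 2 := by
    rw [hcE]
    have : (0:ℝ) ≤ (4 / Real.pi ^ 2) ^ d / 2 := by positivity
    nlinarith
  have hElow : ∀ q ∈ Strip d κ, cE ≤ ‖E n a 0 q‖ := fun q hq =>
    hca.trans (E_lower_of_ImLipschitz n hn a 0 κ ΛE ha0 le_rfl hΛE hLE (hsmallE.trans hca) q hq)
  have hNlow : ∀ q ∈ Strip d κ, cN ≤ ‖Ncal n q‖ :=
    Ncal_lower_of_ImLipschitz n hn κ ΛN hΛN hLN hsmallN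
  obtain ⟨hE0, -, hlow, hup⟩ := m_bounds_of_leaves n a κ cE cN ME MN hcEpos hcNpos hElow hNlow hupE hupN p hp
  exact ⟨hE0, hlow, hup⟩

end

end Literature.MathematicalPhysics.QuantumFieldTheory.Balaban1983to89.B5Strip145
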